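import Summits.QuantumFields.BalabanUV.Beta.CombRemainderParityAllScaled
import Summits.QuantumFields.BalabanUV.Beta.FP.StepKernelWardDataReflTablesAn1
import Summits.QuantumFields.BalabanUV.Beta.FP.StepRecursionFeed
import Summits.QuantumFields.BalabanUV.Beta.CombOneShotJetsTabs

/-!
# `BalabanUV.Beta.FP.StepKernelWardDataRecordScaled` — road «FP» for binder row D1, the OWNER's answer to an2's RULING R-D1-g58-3 («road FP's step-recursion END
# RE-READ AT THE WEIGHTED STEP RECORD `JsB12CombShSym hLc N (symTablesAn1S2w 3 Lc (κ·cΛ) κ) (κ·cΛ) cB` — the `D1Tel` side of the (III″) ITEM»): **hW ∧ hR, THE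
# PER-STEP DATA (hTA, (T0), (T1)) AND M‴'s `htel` AT `JcOfTabs`, ALL AT THE WEIGHTED RECORD, every group weight `κ`** — the κ-twin of #30d
# `FP/StepKernelWardDataRecord` §1–§2 and of #31 `FP/StepRecursionFeedTabs` §1–§2 (at `κ = 1` every statement here is the parent's, `symTablesAn1S2w_one`)

WHY.  The row's (III″) ROOT of record (P5c `CombRemainderParityAllScaled.d1Drift_JsB12CombShSym_an1TablesS2w_pinned_of_locks_D1Tel_D1Rep`, DISPLAY D6
`D1LiteralLagrangianRoot`) reads `htel : D1Tel Lc (JsB12CombShSym hLc N (symTablesAn1S2w 3 Lc (w·cΛ) w) (w·cΛ) cB) Jc` at the WEIGHTED tables; road «FP»'s ENDs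
(#28 `StepRecursionFeed`, #30d, #31, END-Comp, the END wrapper) conclude `D1Tel` at the UNWEIGHTED record only — «until then the two roads meet the (III″) DISPLAY
only at `w₁ = 1`» (R-D1-g58-3).  What the END needs of the step record is exactly (T0)(T1) (+ the depth-1 anchor `hbase`, generic: an2's `TshotOf_JcOfTabs_one`);
(T0)(T1) come from hW ∧ hR (`ScalewiseVectorSeam.scalewiseData_of_printed_flip` at `hdec_TbalOf`), and hW ∧ hR at the weighted record are INSIDE the κ-chain
(leaf-04 ∕ leaf-01 ∕ leaf-03 ∕ an2: `…S2Scaled → S2MScaled → S2MWScaled → S2MWVScaled → S2MWVBScaled → S2RScaled → S2RDScaled → S2ZScaled → S2NScaled → P5c`) as the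
arguments each level passes BY NAME — this file EXPOSES them, #30d's way: §1 composes the substitution levels into ONE application of #30c's GENERIC base twin
`StepKernelWardDataReflTablesAn1.wardRefl_JsB12CombShSym_an1Tables_of_bordMixLetters_reflTableLettersRem` (generic in the second-order tables, so it serves the
weighted mixed table `κ • symMixFFAt ρ_c Lc` verbatim) with THE SCALED LETTERS OF RECORD, read first-hand off the κ-chain's bodies: `κ • symRMAn1`, `hcls_sym_smul`,
`hRMp_sym_of_lock_smul`, `hM₂_sym_smul` (S2MW), `κ • symRMrAn1`, `hM2_smul_symMixFFAt` (S2M), the PINNED contacts at `κ·cΛ` (`hBfm_comb ∕ hBmf_comb ∕ hBmm_comb (κ * cΛ)`,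
S2MWVB), `combR2An1W ∕ h0_combW ∕ combΔAn1W ∕ hsplit_combW ∕ hR2succ_combW` (S2R), `hDg_comb (κ * cΛ)` (S2RD); then `…S2Z` (γ pinned, `X2s := 0`), `…S2N`
(`hΔL_pinnedW`), M‴ (`hRm0W_discharged`).  §2 = (hTA, (T0), (T1)) at the weighted record.  §3 = #31's two ENDs re-read there: M‴'s `htel` at
`Jc := JcOfTabs hLc N tabs cΛs cBs` for ANY scale-indexed record `tabs` whose depth-1 member IS the weighted record (`h1`, an2's `HEq` currency; `cΛs 1 = κ·cΛ`,
`cBs 1 = cB`) — from an4's `StepRecursion` in ONE hypothesis (§3a), resp. from the road's kernel rows (L1)(L2′) alone (§3b).  an2's (III″) `Jc″ := JcOfTabs hLc N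
(fun m ↦ symTablesAn1S2w 3 (Lc^m) (w_m·cΛ_m) w_m) (fun m ↦ w_m·cΛ_m) cB` (SPEC (III″) v1.4 §7 (1)) is the instance `tabs m := symTablesAn1S2w 3 (Lc^m) (w_m·cΛ_m) w_m`.
[folklore] composition BY NAME; no `def`, no `def … : Prop`, nothing cited, 0 sorry.

WHAT STAYS DISPLAYED: §1's letters exactly as in #30d (the locks `hΛ hcB` — Λ-lock on the BASE pin `cΛ`, as in the whole κ-chain —, `γ hγ`, `X2s hX2L`, `hΔL`, `hRm0`,
discharged level by level down to NOTHING but the locks); §3's `hrec` resp. (L1)(L2′), the anchor `h1` and the two depth-1 coefficient pins.  NOT HERE: any claim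
that a `tabs` IS Bałaban's composite record ((C1)); the END wrapper's weighted twin (its G-leg rows `hG hT0 hT1` re-read at the weighted record are the next file).

HONEST DEPENDENCY (page 1, mandatory): continuum YM on T⁴ ⇐ BetaPertH ∧ nine spine estimates (0/9 proved); BetaPertH ⇐ (D1) ∧ (D4) ∧ CAP+tail;
G-an2-4 gates asym, D1 and NE2/3/4.  HONEST FRAMING (cell contract, verbatim): «discharging `BetaPertH` makes Bałaban's UV stability UNCONDITIONAL —
a real constructive-QFT result; it is NOT the continuum limit and NOT the Clay problem.»  ABSOLUTE RULE (cell charter, verbatim): «No internally-minted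
statement may enter as a cited fact. Every hypothesis is either kernel-proved in this package or a verbatim quotation of a PUBLISHED theorem with page
reference. The manuscript(s) under audit are NOT citable for their own disputed steps — they are the thing under adjudication; programme-internal
(2001/route/tribunal) claims are never citable.»  Nothing of Bałaban's asserted; 0 estimates; 0∕4 row-D1 binders DISCHARGED BY THIS FILE (hW ∕ hR at the
locks were already theorems INSIDE the κ-chain — this file only EXPOSES them; `D1Tel` is CONCLUDED only from the displayed `hrec` ∕ rows; `D1Rep` stays the
roads'); ROOT M‴ p325680 and P5c ∕ D6 untouched; NOT (C1), NOT (T-ID), NOT SDF, NOT D1, NOT BetaPertH, NOT continuum, NOT Clay.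
Road «FP» OWNER, b2b-balaban-beta-d1-p3 gen 35, 2026-08-25.  No existing file touched.
-/

noncomputable section

open Finset
open scoped BigOperators
open Literature.MathematicalPhysics.QuantumFieldTheory
open Literature.MathematicalPhysics.QuantumFieldTheory.Balaban1983to89
open Literature.MathematicalPhysics.QuantumFieldTheory.Balaban1983to89.Beta
open ExpKernelCalculus (tadpole)
open PolarizationSign (WardTransversal AxisReflectionCovariant)
open AveragingContoursRooted (ctr)
open OneStepResolventKernel (Fib JetData)
open OneStepKernelFamily (TbalOf flipK D1Tel)
open BalabanStepJetsSucc (wE wVH)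
open BalabanStepW2 (wV4)
open Summit.QuantumFields.BalabanUV.Beta.TameKernelCalculus
open Summit.QuantumFields.BalabanUV.Beta.ChartConjugation (conjV)
open Summit.QuantumFields.BalabanUV.Beta.AxialDressingRooted (one_le_of_neZero)
open Summit.QuantumFields.BalabanUV.Beta.CombChartStepJets (GcombSh)
open Summit.QuantumFields.BalabanUV.Beta.CombChartJointEnd (JsB12CombShSym)
open Summit.QuantumFields.BalabanUV.Beta.SymShiftedSpread (bhKStepSh)
open Summit.QuantumFields.BalabanUV.Beta.BorderedHessian (bhK stepScale diagK)
open Summit.QuantumFields.BalabanUV.Beta.E3ContactGenerator (ctGenM)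
open Summit.QuantumFields.BalabanUV.Beta.DshAn1 (Dsh)
open Summit.QuantumFields.BalabanUV.Beta.SymAveragingMixedJetTables (symMixFFAt)
open Summit.QuantumFields.BalabanUV.Beta.SymSecondOrderTablesAn1 (symVh₂SAn1 symTablesAn1S2 locStencil₂_symVh₂SAn1 symVh₂SAn1_hBt symVh₂SAn1_inl_inl symMixFFAt_hmix_ctr symMixFFAt_hmixt)
open Summit.QuantumFields.BalabanUV.Beta.SymMixedReflectionLetterAn1 (symRMrAn1 hM2_symMixFFAt)
open Summit.QuantumFields.BalabanUV.Beta.CombSecondOrderRemainderAn1 (combΔAn1)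
open Summit.QuantumFields.BalabanUV.Beta.RowD1JointEndSymReflTablesAn1S2Z (loc_diagK_zeroTable)
open Summit.QuantumFields.BalabanUV.Beta.SymSecondOrderTablesAn1 (symVh₂SAn1 symTablesAn1S2)
open Summit.QuantumFields.BalabanUV.Beta.CombSecondOrderRemainderAn1 (combR2An1 combΔAn1)
open Summit.QuantumFields.BalabanUV.Beta.CombSecondOrderDeltaSep (hΔL_pinned)
open OneStepResolventKernel (Fib)
open BalabanStepJetsSucc (wVH)
open Summit.QuantumFields.BalabanUV.Beta.SymSecondOrderTablesAn1 (symVh₂SAn1)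
open Summit.QuantumFields.BalabanUV.Beta.SymMixedReflectionLetterAn1 (symRMrAn1)
open Summit.QuantumFields.BalabanUV.Beta.CombSecondOrderRemainderAn1 (combR2An1 combΔAn1 hR2succ_comb)
open Summit.QuantumFields.BalabanUV.Beta.SymSecondOrderTablesAn1 (symTablesAn1S2)
open OneStepResolventKernel (JetData)
open OneStepKernelFamily (D1Tel)
open Summit.QuantumFields.BalabanUV.Beta.SymWardLettersAn1 (symRMAn1 hcls_sym hRBp_zero hRMp_sym_of_lock hBord0_sym hBord0''_sym hBordS_sym hBordS''_sym hM₂_sym)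
open Summit.QuantumFields.BalabanUV.Beta.SymVhSliceReflectionAn1 (hVfm_sym hVmf_sym hVmm_sym)
open Summit.QuantumFields.BalabanUV.Beta.SymRootedKernelReflection (hHr_sym)
open Summit.QuantumFields.BalabanUV.Beta.CombBorderReflectionLetters (hBfm_comb hBmf_comb hBmm_comb)
open Summit.QuantumFields.BalabanUV.Beta.SymBorderReflectionLetters (hRBrff_zero)
open Summit.QuantumFields.BalabanUV.Beta.CombSecondOrderRemainderAn1 (combR2An1 combΔAn1 h0_comb hsplit_comb hR2succ_comb)
open Summit.QuantumFields.BalabanUV.Beta.CombDressedResponseLoc (hDg_comb)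
open ScalewiseVectorSeam (scalewiseData_of_printed_flip)
open OneStepKernelFamily (hdec_TbalOf TshotOf)
open DecimatedMomentSummable (AbsMoment₂)
open HessianTelescopingKKT (StepRecursion wStep d1Tel_of_stepRecursion_wStep)
open DressedMomentNormalisation (EKer dressedEntry)
open Summit.QuantumFields.BalabanUV.Beta.FP.StepRecursionFeed (d1Tel_JcOf_of_kernel_laws_wStep d1Tel_anchored_of_kernel_laws_wStep)
open Summit.QuantumFields.BalabanUV.Beta.CombOneShotJets (JcOf TshotOf_JcOf_one)
open Summit.QuantumFields.BalabanUV.Beta.CombRemainderParityAll (hRm0_discharged)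
open Summit.QuantumFields.BalabanUV.Beta.FP.StepKernelWardDataReflTablesAn1 (wardRefl_JsB12CombShSym_an1Tables_of_bordMixLetters_reflTableLettersRem)
open Summit.QuantumFields.BalabanUV.Beta.SymTablesAn1S2Weighted (symTablesAn1S2w smul_symMixFFAt_hmix_ctr smul_symMixFFAt_hmixt)
open Summit.QuantumFields.BalabanUV.Beta.SymLamGroupScaling (hM2_smul_symMixFFAt hRMp_sym_of_lock_smul)
open Summit.QuantumFields.BalabanUV.Beta.SymWardLettersAn1Scaled (hM₂_sym_smul hcls_sym_smul)
open Summit.QuantumFields.BalabanUV.Beta.CombSecondOrderRemainderAn1Scaled (combR2An1W combΔAn1W h0_combW hsplit_combW hR2succ_combW)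
open Summit.QuantumFields.BalabanUV.Beta.CombSecondOrderDeltaSepScaled (hΔL_pinnedW)
open Summit.QuantumFields.BalabanUV.Beta.CombRemainderParityAllScaled (hRm0W_discharged)
open Summit.QuantumFields.BalabanUV.Beta.SymmetrisedStepJets (SymTables)
open Summit.QuantumFields.BalabanUV.Beta.CombOneShotJetsTabs (JcOfTabs TshotOf_JcOfTabs_one)
open Summit.QuantumFields.BalabanUV.Beta.FP.StepRecursionFeed (d1Tel_of_kernel_laws_wStep)

namespace Summit.QuantumFields.BalabanUV.Beta.FP.StepKernelWardDataRecordScaled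

variable {Lc : ℕ} [NeZero Lc]

/-! ## §1 hW ∧ hR at the pinned (III″) weighted record: the substitution levels of the ROOT chain composed, then `…S2Z`, `…S2N`, M‴ -/

/-- [folklore] **hW ∧ hR TWIN of `CombChartJointEndReflTablesAn1S2RDScaled.d1Drift_JsB12CombShSym_an1TablesS2w_of_locks_contact_splitLoc_hcomp_D1Tel_D1Rep`, WITH THE
SUBSTITUTION-ONLY ROOTS `…An1S2` (an1's second-order tables), `…S2M` (`symRMrAn1`, `hM2_symMixFFAt`), `…S2MW` (the `_sym` border∕mixed Ward table letters at the locks),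
`…S2MWV` (`hVfm_sym hVmf_sym hVmm_sym hHr_sym`, `hlock2`), `…S2MWVB` (the PINNED first-order contacts: `hBfm_comb hBmf_comb hBmm_comb`, `RBr := 0`) and `…S2R`
(`combR2An1 h0_comb combΔAn1 hsplit_comb hR2succ_comb`) COMPOSED** into ONE application of #30c's twin — every argument the term the corresponding root passes, BY NAME.
Displayed, exactly as in that root: the locks `hΛ hcB`, the contact coefficient `γ` with `hγ`, the cross table `X2s` with `hX2L`, `hΔL`, `hRm0`. -/
theorem wardRefl_JsB12CombShSym_an1TablesS2w_of_locks_contact_splitLoc_hcomp (hLc : Odd Lc) (hL2 : 2 ≤ Lc) {N : ℕ} (hN : 2 ≤ N) (cΛ κ cB : ℝ)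
    -- the two unit locks of an1's TABLE-FIT tier 2 (Λ-lock of `SymMixedWardSiteLaw.symBondWardM`, B-lock of `SymBorderWardSiteLaw.symBondWardB`)
    (hΛ : cΛ * (Lc : ℝ) ^ 4 = 2) (hcB : cB = -((Lc : ℝ) ^ 12 / 4))
    -- the first-order contact coefficient, displayed
    (γ : ℕ → ℝ) (hγ : ∀ j, γ j = -((Lc : ℝ) ^ 8 / 2) * wVH 3 Lc j / (stepScale 3 Lc j * (Lc : ℝ) ^ 4))
    -- hR, SECOND ORDER: the contact table `X2s` (free) with its localisation, and the localisation of the defined split defect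
    (X2s : ℕ → Fin 4 → Fin 4 → (Fin 4 → ℤ) → Fin 4 → (Fin 4 → ℤ) → (Fin 4 → ℤ) → Fib 3 → ℝ)
    (hX2L : ∀ j α μ y ν y', Loc (diagK (X2s j α μ y ν y'))) (hΔL : ∀ j α μ y ν y', Loc (combΔAn1W Lc N cΛ κ γ X2s j α μ y ν y'))
    -- the cancellation of the chart-(II) defect against the W-REMAINDER `Rm_j` (the compensator is now IDENTIFIED: `Wc := Rm`, `X₂ := diagK X2s`) — the (N8) object
    (hRm0 : ∀ (j : ℕ) (α μ : Fin 4) (y : Fin 4 → ℤ) (ν : Fin 4) (y' : Fin 4 → ℤ),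
      tadpole (GcombSh Lc j)
        ((1 / 2 : ℝ) • conjV (bhKStepSh 3 Lc (Dsh Lc) j) (diagK fun p a => X2s j α ν y' μ y p a - X2s j α μ y ν y' p a) +
          (1 / 2 : ℝ) • (combΔAn1W Lc N cΛ κ γ X2s j α μ y ν y' + combΔAn1W Lc N cΛ κ γ X2s j α ν y' μ y)) = 0) :
    (∀ j : ℕ, WardTransversal (flipK (TbalOf Lc (JsB12CombShSym hLc N (symTablesAn1S2w 3 Lc (κ * cΛ) κ) (κ * cΛ) cB) j))) ∧
      (∀ j : ℕ, AxisReflectionCovariant (flipK (TbalOf Lc (JsB12CombShSym hLc N (symTablesAn1S2w 3 Lc (κ * cΛ) κ) (κ * cΛ) cB) j))) := by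
  subst hcB
  have hLc1 : 1 ≤ Lc := le_trans one_le_two hL2
  have hlock2 : ∀ j : ℕ, ((Lc : ℝ) ^ 8) * wV4 3 Lc (j + 1) * wVH 3 Lc (j + 1) = ((Lc : ℝ) ^ 4 * wE 3 Lc (j + 1)) ^ 2 := fun j => by
    simp only [BalabanStepW2.wV4, BalabanStepJetsSucc.wVH, BalabanStepJetsSucc.wE]
    ring
  exact wardRefl_JsB12CombShSym_an1Tables_of_bordMixLetters_reflTableLettersRem hLc hN (κ * cΛ) (-((Lc : ℝ) ^ 12 / 4))
    (symVh₂SAn1 3 Lc) (κ • symMixFFAt (ctr 4 Lc) Lc) (locStencil₂_symVh₂SAn1 (one_le_of_neZero Lc)) (smul_symMixFFAt_hmix_ctr (one_le_of_neZero Lc) κ)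
    (symVh₂SAn1_hBt (one_le_of_neZero Lc)) (smul_symMixFFAt_hmixt (ctr 4 Lc) Lc κ)
    0 0 (fun j y ρ' w => κ • symRMAn1 Lc cΛ j y ρ' w) (hcls_sym_smul hLc1 cΛ κ 0) (fun j => hcls_sym_smul hLc1 cΛ κ (j + 1)) hRBp_zero hRBp_zero
    (hRMp_sym_of_lock_smul hΛ κ) (hBord0_sym hLc) (hBord0''_sym hLc) (hBordS_sym hLc) (hBordS''_sym hLc) (hM₂_sym_smul cΛ κ)
    (hVfm_sym hLc) (hVmf_sym hLc) (hVmm_sym hLc) (hHr_sym hLc) γ hγ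
    (fun κ₁ u κ₁' u' x z β β' => symVh₂SAn1_inl_inl Lc κ₁ u κ₁' u' x z β β') hlock2
    (fun j α κ₁ u κ₁' u' p c => (γ j * ctGenM 3 (bhK Lc + Dsh Lc) α Lc κ₁ u p c) * (γ j * ctGenM 3 (bhK Lc + Dsh Lc) α Lc κ₁' u' p c))
    (combR2An1W Lc N cΛ κ γ X2s) (fun j α κ₁ u ρ w => κ • symRMrAn1 Lc cΛ γ j α κ₁ u ρ w) (h0_combW N cΛ κ γ X2s) (hM2_smul_symMixFFAt hLc κ cΛ γ)
    X2s (combΔAn1W Lc N cΛ κ γ X2s) (hsplit_combW N cΛ κ γ X2s) (hDg_comb (κ * cΛ) γ) hX2L hΔL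
    0 hRBrff_zero (hBfm_comb hLc (κ * cΛ) γ hγ) (hBmf_comb hLc (κ * cΛ) γ hγ) (hBmm_comb (κ * cΛ) γ) (hR2succ_combW N cΛ κ γ X2s) hRm0


/-- [folklore] **hW ∧ hR TWIN of `CombChartJointEndReflTablesAn1S2ZScaled.d1Drift_JsB12CombShSym_an1TablesS2w_pinned_of_locks_splitLoc_hcomp_D1Tel_D1Rep`** (ROOT chain F′ … M‴ of row D1, chart (III′)): the SAME letters, the conclusion
replaced by the Ward transversality and the axis-reflection covariance of the flipped step kernels `flipK (TbalOf Lc (JsB12CombShSym …) j)`, every `j`;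
proof = the original body with its callee replaced by the callee's twin (route binders dropped). -/
theorem wardRefl_JsB12CombShSym_an1TablesS2w_pinned_of_locks_splitLoc_hcomp (hLc : Odd Lc) (hL2 : 2 ≤ Lc) {N : ℕ} (hN : 2 ≤ N) (cΛ κ cB : ℝ)
    -- the two unit locks of an1's TABLE-FIT tier 2 (Λ-lock of `SymMixedWardSiteLaw.symBondWardM`, B-lock of `SymBorderWardSiteLaw.symBondWardB`)
    (hΛ : cΛ * (Lc : ℝ) ^ 4 = 2) (hcB : cB = -((Lc : ℝ) ^ 12 / 4))
    -- hR, SECOND ORDER: the localisation of the defined split defect at the pinned contact data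
    (hΔL : ∀ j α μ y ν y', Loc (combΔAn1W Lc N cΛ κ (fun j => -((Lc : ℝ) ^ 8 / 2) * wVH 3 Lc j / (stepScale 3 Lc j * (Lc : ℝ) ^ 4)) (0 : ℕ → Fin 4 → Fin 4 → (Fin 4 → ℤ) → Fin 4 → (Fin 4 → ℤ) → (Fin 4 → ℤ) → Fib 3 → ℝ) j α μ y ν y'))
    -- the cancellation of the chart-(II) defect against the W-REMAINDER `Rm_j` (`Wc := Rm`, `X₂ := 0`) — the (N8) object
    (hRm0 : ∀ (j : ℕ) (α μ : Fin 4) (y : Fin 4 → ℤ) (ν : Fin 4) (y' : Fin 4 → ℤ),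
      tadpole (GcombSh Lc j)
        ((1 / 2 : ℝ) • conjV (bhKStepSh 3 Lc (Dsh Lc) j) (diagK fun p a => (0 : ℕ → Fin 4 → Fin 4 → (Fin 4 → ℤ) → Fin 4 → (Fin 4 → ℤ) → (Fin 4 → ℤ) → Fib 3 → ℝ) j α ν y' μ y p a - (0 : ℕ → Fin 4 → Fin 4 → (Fin 4 → ℤ) → Fin 4 → (Fin 4 → ℤ) → (Fin 4 → ℤ) → Fib 3 → ℝ) j α μ y ν y' p a) +
          (1 / 2 : ℝ) • (combΔAn1W Lc N cΛ κ (fun j => -((Lc : ℝ) ^ 8 / 2) * wVH 3 Lc j / (stepScale 3 Lc j * (Lc : ℝ) ^ 4)) (0 : ℕ → Fin 4 → Fin 4 → (Fin 4 → ℤ) → Fin 4 → (Fin 4 → ℤ) → (Fin 4 → ℤ) → Fib 3 → ℝ) j α μ y ν y' + combΔAn1W Lc N cΛ κ (fun j => -((Lc : ℝ) ^ 8 / 2) * wVH 3 Lc j / (stepScale 3 Lc j * (Lc : ℝ) ^ 4)) (0 : ℕ → Fin 4 → Fin 4 → (Fin 4 → ℤ) → Fin 4 → (Fin 4 → ℤ)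 → (Fin 4 → ℤ) → Fib 3 → ℝ) j α ν y' μ y)) = 0) :
    (∀ j : ℕ, WardTransversal (flipK (TbalOf Lc (JsB12CombShSym hLc N (symTablesAn1S2w 3 Lc (κ * cΛ) κ) (κ * cΛ) cB) j))) ∧
      (∀ j : ℕ, AxisReflectionCovariant (flipK (TbalOf Lc (JsB12CombShSym hLc N (symTablesAn1S2w 3 Lc (κ * cΛ) κ) (κ * cΛ) cB) j))) := by
  exact wardRefl_JsB12CombShSym_an1TablesS2w_of_locks_contact_splitLoc_hcomp hLc hL2 hN cΛ κ cB hΛ hcB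
    (fun j => -((Lc : ℝ) ^ 8 / 2) * wVH 3 Lc j / (stepScale 3 Lc j * (Lc : ℝ) ^ 4)) (fun _ => rfl) 0 loc_diagK_zeroTable hΔL hRm0

/-- [folklore] **hW ∧ hR TWIN of `CombChartJointEndReflTablesAn1S2NScaled.d1Drift_JsB12CombShSym_an1TablesS2w_pinned_of_locks_hcomp_D1Tel_D1Rep`** (ROOT chain F′ … M‴ of row D1, chart (III′)): the SAME letters, the conclusion
replaced by the Ward transversality and the axis-reflection covariance of the flipped step kernels `flipK (TbalOf Lc (JsB12CombShSym …) j)`, every `j`;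
proof = the original body with its callee replaced by the callee's twin (route binders dropped). -/
theorem wardRefl_JsB12CombShSym_an1TablesS2w_pinned_of_locks_hcomp (hLc : Odd Lc) (hL2 : 2 ≤ Lc) {N : ℕ} (hN : 2 ≤ N) (cΛ κ cB : ℝ)
    -- the two unit locks of an1's TABLE-FIT tier 2
    (hΛ : cΛ * (Lc : ℝ) ^ 4 = 2) (hcB : cB = -((Lc : ℝ) ^ 12 / 4))
    -- the cancellation against the W-REMAINDER `Rm_j` at `X2s := 0` — the repair track's scalar `hRm0` (LOCATED: the (E0) table, HRM0-AN3 §4)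
    (hRm0 : ∀ (j : ℕ) (α μ : Fin 4) (y : Fin 4 → ℤ) (ν : Fin 4) (y' : Fin 4 → ℤ),
      tadpole (GcombSh Lc j)
        ((1 / 2 : ℝ) • conjV (bhKStepSh 3 Lc (Dsh Lc) j) (diagK fun p a => (0 : ℕ → Fin 4 → Fin 4 → (Fin 4 → ℤ) → Fin 4 → (Fin 4 → ℤ) → (Fin 4 → ℤ) → Fib 3 → ℝ) j α ν y' μ y p a - (0 : ℕ → Fin 4 → Fin 4 → (Fin 4 → ℤ) → Fin 4 → (Fin 4 → ℤ) → (Fin 4 → ℤ) → Fib 3 → ℝ) j α μ y ν y' p a) +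
          (1 / 2 : ℝ) • (combΔAn1W Lc N cΛ κ (fun j => -((Lc : ℝ) ^ 8 / 2) * wVH 3 Lc j / (stepScale 3 Lc j * (Lc : ℝ) ^ 4)) (0 : ℕ → Fin 4 → Fin 4 → (Fin 4 → ℤ) → Fin 4 → (Fin 4 → ℤ) → (Fin 4 → ℤ) → Fib 3 → ℝ) j α μ y ν y' + combΔAn1W Lc N cΛ κ (fun j => -((Lc : ℝ) ^ 8 / 2) * wVH 3 Lc j / (stepScale 3 Lc j * (Lc : ℝ) ^ 4)) (0 : ℕ → Fin 4 → Fin 4 → (Fin 4 → ℤ) → Fin 4 → (Fin 4 → ℤ) → (Fin 4 → ℤ) → Fib 3 → ℝ) j α ν y' μ y)) = 0) :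
    (∀ j : ℕ, WardTransversal (flipK (TbalOf Lc (JsB12CombShSym hLc N (symTablesAn1S2w 3 Lc (κ * cΛ) κ) (κ * cΛ) cB) j))) ∧
      (∀ j : ℕ, AxisReflectionCovariant (flipK (TbalOf Lc (JsB12CombShSym hLc N (symTablesAn1S2w 3 Lc (κ * cΛ) κ) (κ * cΛ) cB) j))) := by
  exact wardRefl_JsB12CombShSym_an1TablesS2w_pinned_of_locks_splitLoc_hcomp hLc hL2 hN cΛ κ cB hΛ hcB
    (hΔL_pinnedW N cΛ κ (fun j => -((Lc : ℝ) ^ 8 / 2) * wVH 3 Lc j / (stepScale 3 Lc j * (Lc : ℝ) ^ 4))) hRm0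

/-- [folklore] **hW ∧ hR TWIN of `CombRemainderParityAllScaled.d1Drift_JsB12CombShSym_an1TablesS2w_pinned_of_locks_D1Tel_D1Rep`** (ROOT chain F′ … M‴ of row D1, chart (III′)): the SAME letters, the conclusion
replaced by the Ward transversality and the axis-reflection covariance of the flipped step kernels `flipK (TbalOf Lc (JsB12CombShSym …) j)`, every `j`;
proof = the original body with its callee replaced by the callee's twin (route binders dropped). -/
theorem wardRefl_JsB12CombShSym_an1TablesS2w_pinned_of_locks (hLc : Odd Lc) (hL2 : 2 ≤ Lc) {N : ℕ} (hN : 2 ≤ N) (cΛ κ cB : ℝ)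
    -- the two unit locks of an1's TABLE-FIT tier 2
    (hΛ : cΛ * (Lc : ℝ) ^ 4 = 2) (hcB : cB = -((Lc : ℝ) ^ 12 / 4)) :
    (∀ j : ℕ, WardTransversal (flipK (TbalOf Lc (JsB12CombShSym hLc N (symTablesAn1S2w 3 Lc (κ * cΛ) κ) (κ * cΛ) cB) j))) ∧
      (∀ j : ℕ, AxisReflectionCovariant (flipK (TbalOf Lc (JsB12CombShSym hLc N (symTablesAn1S2w 3 Lc (κ * cΛ) κ) (κ * cΛ) cB) j))) :=
  wardRefl_JsB12CombShSym_an1TablesS2w_pinned_of_locks_hcomp hLc hL2 hN cΛ κ cB hΛ hcB (hRm0W_discharged (Lc := Lc) hLc hN κ hΛ)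

/-! ## §2 The per-step data (hTA, (T0), (T1)) of the (III″) WEIGHTED record, DISCHARGED -/

/-- [folklore] **hTA ∧ (T0) ∧ (T1) FOR THE STEP KERNELS OF THE (III′) LITERAL OF RECORD** (`Odd Lc`, `2 ≤ Lc`, `2 ≤ N`, the two unit locks `hΛ hcB` of M‴ — nothing
else): absolutely summable second moments, vanishing zeroth moments and vanishing first moments of every channel of
`TbalOf Lc (JsB12CombShSym hLc N (symTablesAn1S2w 3 Lc (κ * cΛ) κ) (κ * cΛ) cB) j`, every `j` — the β-lead's `ScalewiseVectorSeam.scalewiseData_of_printed_flip` at the uniform decay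
`hdec_TbalOf` and §1's hW ∧ hR (`RowD1Telescoping.stepData_JsRowD1Pin`'s pattern, for the newer literal). -/
theorem stepData_JsB12CombShSym_an1S2w_pinned (hLc : Odd Lc) (hL2 : 2 ≤ Lc) {N : ℕ} (hN : 2 ≤ N) (cΛ κ cB : ℝ)
    (hΛ : cΛ * (Lc : ℝ) ^ 4 = 2) (hcB : cB = -((Lc : ℝ) ^ 12 / 4)) :
    (∀ j (c e : Fin 4), AbsMoment₂ (TbalOf Lc (JsB12CombShSym hLc N (symTablesAn1S2w 3 Lc (κ * cΛ) κ) (κ * cΛ) cB) j c e)) ∧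
      (∀ j (c e : Fin 4), HasSum (TbalOf Lc (JsB12CombShSym hLc N (symTablesAn1S2w 3 Lc (κ * cΛ) κ) (κ * cΛ) cB) j c e) 0) ∧
        (∀ j (c e ρ : Fin 4), HasSum (fun t : Fin 4 → ℤ => t ρ • TbalOf Lc (JsB12CombShSym hLc N (symTablesAn1S2w 3 Lc (κ * cΛ) κ) (κ * cΛ) cB) j c e t) 0) :=
  scalewiseData_of_printed_flip (hdec_TbalOf (JsB12CombShSym hLc N (symTablesAn1S2w 3 Lc (κ * cΛ) κ) (κ * cΛ) cB))
    (wardRefl_JsB12CombShSym_an1TablesS2w_pinned_of_locks hLc hL2 hN cΛ κ cB hΛ hcB).1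
    (wardRefl_JsB12CombShSym_an1TablesS2w_pinned_of_locks hLc hL2 hN cΛ κ cB hΛ hcB).2

/-- [folklore] (T0) of the step kernels of the (III″) WEIGHTED record — #28 §5's `hT0` VERBATIM, now a theorem. -/
theorem stepT0_JsB12CombShSym_an1S2w_pinned (hLc : Odd Lc) (hL2 : 2 ≤ Lc) {N : ℕ} (hN : 2 ≤ N) (cΛ κ cB : ℝ)
    (hΛ : cΛ * (Lc : ℝ) ^ 4 = 2) (hcB : cB = -((Lc : ℝ) ^ 12 / 4)) :
    ∀ j (c e : Fin 4), HasSum (TbalOf Lc (JsB12CombShSym hLc N (symTablesAn1S2w 3 Lc (κ * cΛ) κ) (κ * cΛ) cB) j c e) 0 :=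
  (stepData_JsB12CombShSym_an1S2w_pinned hLc hL2 hN cΛ κ cB hΛ hcB).2.1

/-- [folklore] (T1) of the step kernels of the (III″) WEIGHTED record — #28 §5's `hT1` VERBATIM, now a theorem. -/
theorem stepT1_JsB12CombShSym_an1S2w_pinned (hLc : Odd Lc) (hL2 : 2 ≤ Lc) {N : ℕ} (hN : 2 ≤ N) (cΛ κ cB : ℝ)
    (hΛ : cΛ * (Lc : ℝ) ^ 4 = 2) (hcB : cB = -((Lc : ℝ) ^ 12 / 4)) :
    ∀ j (c e ρ : Fin 4), HasSum (fun t : Fin 4 → ℤ => t ρ • TbalOf Lc (JsB12CombShSym hLc N (symTablesAn1S2w 3 Lc (κ * cΛ) κ) (κ * cΛ) cB) j c e t) 0 :=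
  (stepData_JsB12CombShSym_an1S2w_pinned hLc hL2 hN cΛ κ cB hΛ hcB).2.2

/-- [folklore] hTA (absolutely summable second moments) of the step kernels of the (III″) WEIGHTED record (also an4's `hTA_TbalOf` — here in the bundle). -/
theorem stepTA_JsB12CombShSym_an1S2w_pinned (hLc : Odd Lc) (hL2 : 2 ≤ Lc) {N : ℕ} (hN : 2 ≤ N) (cΛ κ cB : ℝ)
    (hΛ : cΛ * (Lc : ℝ) ^ 4 = 2) (hcB : cB = -((Lc : ℝ) ^ 12 / 4)) :
    ∀ j (c e : Fin 4), AbsMoment₂ (TbalOf Lc (JsB12CombShSym hLc N (symTablesAn1S2w 3 Lc (κ * cΛ) κ) (κ * cΛ) cB) j c e) :=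
  (stepData_JsB12CombShSym_an1S2w_pinned hLc hL2 hN cΛ κ cB hΛ hcB).1

/-! ## §3 Road «FP»'s END RE-READ AT THE WEIGHTED STEP RECORD (R-D1-g58-3): M‴'s `htel` at `JcOfTabs` — #31 §1 ∕ §2's κ-twins -/

/-- [folklore] **`D1Tel` AT THE (III″) WEIGHTED RECORD FOR `JcOfTabs`, FROM an4's `StepRecursion` IN ONE HYPOTHESIS** (κ-twin of
`StepRecursionFeedTabs.d1Tel_JcOfTabs_of_stepRecursion_wStep_pinned`): for any scale-indexed record `tabs` whose depth-1 member is the weighted record (`h1`)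
and coefficient sequences pinned at depth 1 (`hcΛ1 hcB1`), an4's `d1Tel_of_stepRecursion_wStep` with (T0)(T1) from §2 and `hbase := TshotOf_JcOfTabs_one`. -/
theorem d1Tel_JcOfTabs_of_stepRecursion_wStep_pinned_w (hLc : Odd Lc) (hL2 : 2 ≤ Lc) {N : ℕ} (hN : 2 ≤ N) (cΛ κ cB : ℝ)
    (hΛ : cΛ * (Lc : ℝ) ^ 4 = 2) (hcB : cB = -((Lc : ℝ) ^ 12 / 4)) (tabs : ∀ m : ℕ, SymTables 3 (Lc ^ m)) (cΛs cBs : ℕ → ℝ)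
    (hcΛ1 : cΛs 1 = κ * cΛ) (hcB1 : cBs 1 = cB) (h1 : HEq (tabs 1) (symTablesAn1S2w 3 Lc (κ * cΛ) κ))
    (hrec : StepRecursion Lc (TbalOf Lc (JsB12CombShSym hLc N (symTablesAn1S2w 3 Lc (κ * cΛ) κ) (κ * cΛ) cB)) (TshotOf Lc (JcOfTabs hLc N tabs cΛs cBs))
      (wStep Lc)) :
    D1Tel Lc (JsB12CombShSym hLc N (symTablesAn1S2w 3 Lc (κ * cΛ) κ) (κ * cΛ) cB) (JcOfTabs hLc N tabs cΛs cBs) := by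
  have hbase := TshotOf_JcOfTabs_one hLc N tabs cΛs cBs (symTablesAn1S2w 3 Lc (κ * cΛ) κ) h1
  rw [hcΛ1, hcB1] at hbase
  exact d1Tel_of_stepRecursion_wStep _ _ (stepT0_JsB12CombShSym_an1S2w_pinned hLc hL2 hN cΛ κ cB hΛ hcB)
    (stepT1_JsB12CombShSym_an1S2w_pinned hLc hL2 hN cΛ κ cB hΛ hcB) hbase hrec

/-- [folklore] **`D1Tel` AT THE (III″) WEIGHTED RECORD FOR `JcOfTabs`, FROM THE ROAD's KERNEL ROWS (L1)(L2′) ALONE** (κ-twin of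
`StepRecursionFeedTabs.d1Tel_JcOfTabs_of_kernel_laws_wStep_pinned`): #28 §3 `d1Tel_of_kernel_laws_wStep` with (L3′) `hbase := TshotOf_JcOfTabs_one … h1`
(coefficients re-read through `hcΛ1 hcB1`) and (L4′) `hT0 hT1 :=` §2.  Displayed: (L1) `hlaw`, (L2′) `hN' hF hG` at the canonical weight, the anchor, the locks. -/
theorem d1Tel_JcOfTabs_of_kernel_laws_wStep_pinned_w (hLc : Odd Lc) (hL2 : 2 ≤ Lc) {N : ℕ} (hN : 2 ≤ N) (cΛ κ cB : ℝ)
    (hΛ : cΛ * (Lc : ℝ) ^ 4 = 2) (hcB : cB = -((Lc : ℝ) ^ 12 / 4)) (tabs : ∀ m : ℕ, SymTables 3 (Lc ^ m)) (cΛs cBs : ℕ → ℝ)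
    (hcΛ1 : cΛs 1 = κ * cΛ) (hcB1 : cBs 1 = cB) (h1 : HEq (tabs 1) (symTablesAn1S2w 3 Lc (κ * cΛ) κ)) (𝒦N 𝒦F 𝒦G : ℕ → EKer 4)
    (hlaw : ∀ j : ℕ, 1 ≤ j → ∀ (a b : Fin 4) (z : Fin 4 → ℤ), 𝒦N j a b z = 𝒦F j a b z + 𝒦G j a b z)
    (hN' : ∀ j : ℕ, 1 ≤ j → ∀ (a b : Fin 4) (z : Fin 4 → ℤ), 𝒦N j a b z = TshotOf Lc (JcOfTabs hLc N tabs cΛs cBs) (j + 1) a b z)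
    (hF : ∀ j : ℕ, 1 ≤ j → ∀ (a b : Fin 4) (z : Fin 4 → ℤ),
      𝒦F j a b z = (Lc : ℝ) ^ 8 * dressedEntry (wStep Lc j) (TshotOf Lc (JcOfTabs hLc N tabs cΛs cBs) j) ((Lc : ℤ) • z) a b)
    (hG : ∀ j : ℕ, 1 ≤ j → ∀ (a b : Fin 4) (z : Fin 4 → ℤ),
      𝒦G j a b z = TbalOf Lc (JsB12CombShSym hLc N (symTablesAn1S2w 3 Lc (κ * cΛ) κ) (κ * cΛ) cB) j a b z) :
    D1Tel Lc (JsB12CombShSym hLc N (symTablesAn1S2w 3 Lc (κ * cΛ) κ) (κ * cΛ) cB) (JcOfTabs hLc N tabs cΛs cBs) := by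
  have hbase := TshotOf_JcOfTabs_one hLc N tabs cΛs cBs (symTablesAn1S2w 3 Lc (κ * cΛ) κ) h1
  rw [hcΛ1, hcB1] at hbase
  exact d1Tel_of_kernel_laws_wStep _ _ 𝒦N 𝒦F 𝒦G hlaw hN' hF hG (stepT0_JsB12CombShSym_an1S2w_pinned hLc hL2 hN cΛ κ cB hΛ hcB)
    (stepT1_JsB12CombShSym_an1S2w_pinned hLc hL2 hN cΛ κ cB hΛ hcB) hbase

end Summit.QuantumFields.BalabanUV.Beta.FP.StepKernelWardDataRecordScaled

end
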